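import Summits.MatrixMultiplication.MatrixMultiplication.Theorems.ObstructionDescentOddLevelFormatTwo

set_option linter.dupNamespace false

/-!
# Obstruction descent, part P — the odd-level pair law for CORNER formats

`route-MatrixMultiplication-ObstructionDescent`, aside `InvariantSaturation` (stmt 32282); decomp-mm lens-3, NODE-g15.

Parts K–N proved the pair law for the FULL format: an odd level `k` (more generally a level empty at block format `2`)
of type `((k^m))³` vanishes on every tensor of rank `≤ r` with `(k−1)(r−1) < k(m−1)`.  The unit-tensor obstructions of
the route live in CORNER formats `((0^{m−N}, k^N))³ = rectType m N k` (the `SL_N³`-invariants of level `k` of the corner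
`ℂ^N ⊗ ℂ^N ⊗ ℂ^N`, read at format `m ≥ N`).  By part L (`exists_eq_liftPoly_of_mem_hwvSpace`) such a vector only involves
the corner variables, `F = liftPoly d f` with `f` a full-format vector at format `N`, and `F(t) = f(corner of t)` with
`R(corner of t) ≤ R(t)`.  Hence (this file):

* `evalT_eq_zero_of_odd_level_corner` — for ODD `k`, `2 ≤ N ≤ m`, every `F ∈ hwvSpace (rectType m N k) (kN)` vanishes on
  all tensors `t` of format `m` with `(k−1)(R(t)−1) < k(N−1)`; at level `3`: on all `t` with `2·R(t) + 1 < 3N`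
  (`evalT_eq_zero_of_level_three_corner`);
* contrapositive LOWER-BOUND form (`le_tensorRank_of_level_three_ne_zero`): a level-`3` corner vector that does not vanish
  at `t` certifies `3N ≤ 2·R(t) + 1`, i.e. `R(t) ≥ ⌈(3N−1)/2⌉`;
* orbit form (`hwvSpace_le_orbitVanishing_of_level_three_corner`): level `3` of the corner-`N` tower lies in `I(GL_m³·u)`
  for every `u` with `2·R(u) + 1 < 3N` — in particular in `I(GL_m³·⟨m⟩)` whenever `2m + 1 < 3N`
  (`three_not_mem_passLevels_of_lt`: level `3` does not pass below the threshold `m ≥ (3N−1)/2`).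

[cite: BurgisserIkenmeyer2011, §3.1–3.2 and §6.2], [cite: BurgisserIkenmeyer2017, §5 (5.2), Thm 5.3],
[cite: LandsbergGCT2017, §8.3.4].
-/

noncomputable section

open scoped BigOperators
open Finset

namespace Summit.MatrixMultiplication.MatrixMultiplication.Theorems.ObstructionCalculus

open Literature.Computability.AlgebraicComplexity (actTensor actTensor_apply unitTensor tensorRestrictsTo_actTensor
  tensorRank_precomp_le tensorRank TensorRestrictsTo)

section CornerOddLevel

/-- The corner of a tensor has rank at most that of the tensor. [bookkeeping] -/
theorem tensorRank_cornerOf_le (d : ℕ) {m : ℕ} (t : Tensor ℂ (d + m)) : tensorRank (cornerOf d t) ≤ tensorRank t :=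
  tensorRank_precomp_le t _ _ _

/-- **Pair law for corner formats (empty-at-format-2 levels).**  If `k ∈ emptyLevels 2 2` and `2 ≤ N`, every weight vector
of corner type `((0^d, k^N))³` in degree `kN` vanishes on all tensors of rank `≤ r` with `(k−1)(r−1) < k(N−1)`. [this node] -/
theorem evalT_eq_zero_of_emptyLevel_two_two_corner {d N k : ℕ} (hk : k ∈ emptyLevels 2 2) (hN : 2 ≤ N)
    {F : MvPolynomial (Idx (d + N)) ℂ} (hF : F ∈ hwvSpace (rectType (d + N) N k) (k * N)) {r : ℕ}
    (hr : (k - 1) * (r - 1) < k * (N - 1)) {t : Tensor ℂ (d + N)} (ht : tensorRank t ≤ r) : evalT t F = 0 := by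
  obtain ⟨f, hf, rfl⟩ := exists_eq_liftPoly_of_mem_hwvSpace le_rfl hF
  rw [evalT_liftPoly]
  exact evalT_eq_zero_of_emptyLevel_two_two hk hN hf hr ((tensorRank_cornerOf_le d t).trans ht)

/-- **The odd-level pair law for corner formats.**  For ODD `k` and `2 ≤ N ≤ m`, every weight vector of corner type
`rectType m N k` in degree `kN` vanishes on all tensors `t` of format `m` with `(k−1)(r−1) < k(N−1)`, `R(t) ≤ r`.
[this node] -/
theorem evalT_eq_zero_of_odd_level_corner {m N k : ℕ} (hk : Odd k) (hN : 2 ≤ N) (hNm : N ≤ m)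
    {F : MvPolynomial (Idx m) ℂ} (hF : F ∈ hwvSpace (rectType m N k) (k * N)) {r : ℕ}
    (hr : (k - 1) * (r - 1) < k * (N - 1)) {t : Tensor ℂ m} (ht : tensorRank t ≤ r) : evalT t F = 0 := by
  obtain ⟨d, rfl⟩ : ∃ d, m = d + N := ⟨m - N, by omega⟩
  exact evalT_eq_zero_of_emptyLevel_two_two_corner (mem_emptyLevels_two_two_of_odd hk) hN hF hr ht

/-- **Level 3, corner formats:** for `2 ≤ N ≤ m`, every weight vector of corner type `rectType m N 3` in degree `3N`
vanishes on all tensors `t` of format `m` with `2·r + 1 < 3N`, `R(t) ≤ r`. [this node] -/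
theorem evalT_eq_zero_of_level_three_corner {m N : ℕ} (hN : 2 ≤ N) (hNm : N ≤ m) {F : MvPolynomial (Idx m) ℂ}
    (hF : F ∈ hwvSpace (rectType m N 3) (3 * N)) {r : ℕ} (hr : 2 * r + 1 < 3 * N) {t : Tensor ℂ m}
    (ht : tensorRank t ≤ r) : evalT t F = 0 := by
  have hr' : (3 - 1) * (r - 1) < 3 * (N - 1) := by omega
  exact evalT_eq_zero_of_odd_level_corner (by decide) hN hNm hF hr' ht

/-- **Lower-bound form.**  A level-`3` corner vector (`2 ≤ N ≤ m`) that does not vanish at `t` certifies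
`3N ≤ 2·R(t) + 1`, i.e. `R(t) ≥ ⌈(3N−1)/2⌉`. [this node] -/
theorem le_tensorRank_of_level_three_ne_zero {m N : ℕ} (hN : 2 ≤ N) (hNm : N ≤ m) {F : MvPolynomial (Idx m) ℂ}
    (hF : F ∈ hwvSpace (rectType m N 3) (3 * N)) {t : Tensor ℂ m} (ht : evalT t F ≠ 0) :
    3 * N ≤ 2 * tensorRank t + 1 := by
  by_contra h
  exact ht (evalT_eq_zero_of_level_three_corner hN hNm hF (by omega) le_rfl)

/-- **Lower-bound form, odd levels.**  An odd-level-`k` corner vector (`2 ≤ N ≤ m`) that does not vanish at `t`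
certifies `k(N−1) ≤ (k−1)(R(t)−1)`. [this node] -/
theorem le_tensorRank_of_odd_level_ne_zero {m N k : ℕ} (hk : Odd k) (hN : 2 ≤ N) (hNm : N ≤ m)
    {F : MvPolynomial (Idx m) ℂ} (hF : F ∈ hwvSpace (rectType m N k) (k * N)) {t : Tensor ℂ m} (ht : evalT t F ≠ 0) :
    k * (N - 1) ≤ (k - 1) * (tensorRank t - 1) := by
  by_contra h
  exact ht (evalT_eq_zero_of_odd_level_corner hk hN hNm hF (by omega) le_rfl)

/-- Odd levels are not levels of low-rank points, corner form. [this node] -/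
theorem not_mem_pointLevels_of_odd_level_corner {m N k : ℕ} (hk : Odd k) (hN : 2 ≤ N) (hNm : N ≤ m) {r : ℕ}
    (hr : (k - 1) * (r - 1) < k * (N - 1)) {t : Tensor ℂ m} (ht : tensorRank t ≤ r) : k ∉ pointLevels N t := by
  rintro ⟨F, hF, hne⟩
  exact hne (evalT_eq_zero_of_odd_level_corner hk hN hNm hF hr ht)

/-- **Orbit form at level 3.**  For `2 ≤ N ≤ m`, level `3` of the corner-`N` tower lies in the ideal of the orbit
`GL_m³·u` of every tensor `u` with `2·R(u) + 1 < 3N`. [this node] -/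
theorem hwvSpace_le_orbitVanishing_of_level_three_corner {m N : ℕ} (hN : 2 ≤ N) (hNm : N ≤ m) {u : Tensor ℂ m}
    (hu : 2 * tensorRank u + 1 < 3 * N) : hwvSpace (rectType m N 3) (3 * N) ≤ orbitVanishing u := by
  intro F hF A B C _ _ _
  exact evalT_eq_zero_of_level_three_corner hN hNm hF hu (tensorRestrictsTo_actTensor A B C u).tensorRank_le

/-- `R(⟨m⟩) ≤ m`. [bookkeeping] -/
theorem tensorRank_unitTensor_le' (m : ℕ) : tensorRank (unitTensor ℂ m) ≤ m :=
  Literature.Barriers.MatrixMultiplication.tensorRank_unitTensor_le (K := ℂ) m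

/-- **Level 3 does not pass below the threshold `m ≥ (3N−1)/2`:** for `2 ≤ N ≤ m` with `2m + 1 < 3N`, every level-`3`
vector of the corner-`N` tower vanishes on `GL_m³·⟨m⟩`, i.e. `3 ∉ passLevels m N`. [this node] -/
theorem three_not_mem_passLevels_of_lt {m N : ℕ} (hN : 2 ≤ N) (hNm : N ≤ m) (hm : 2 * m + 1 < 3 * N) :
    3 ∉ passLevels m N := fun h =>
  h (hwvSpace_le_orbitVanishing_of_level_three_corner hN hNm (by
    have := tensorRank_unitTensor_le' m
    omega))

end CornerOddLevel

end Summit.MatrixMultiplication.MatrixMultiplication.Theorems.ObstructionCalculus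

end
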